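import Summits.QuantumAdvantage.QuantumAdvantage.Theorems.CubicForrelationNearExactIsExactCubicFormTransport
import Summits.QuantumAdvantage.QuantumAdvantage.Theorems.CubicForrelationNearExactIsExactTwelvePartnerR2Blocks
import Summits.QuantumAdvantage.QuantumAdvantage.Theorems.CubicForrelationNearExactIsExactTwelvePartnerTrace

/-!
# Crux `CubicForrelation.NearExactIsExact` (stmt-QuantumAdvantage-14043) — E1280-even, R2 branch: frame-identity tools and the ZERO descendant

Certificate seat `b2b-cforr-cert` (gen 42).  HONEST FRAMING: kernel-checked bookkeeping (standard axioms) for the branch statement `HR2` of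
`tpw_weight_ge_1280_of_branches` (…TwelvePartnerLight), in the adapted frame of `tpw_R2_partner_frame` (…CubicFormR2Partner):
* `tpw_F1_of_frame_identity`: the frame identity `κ(y) ⊕ κ(y ⊕ e₀) = y₁ y₂` gives `hF1`: `d(e₀,j,k) = [{j,k} = {e₁,e₂}]` for the cubic
  form `d` of `κ` (`tct_third_of_product_slice`; no degree hypothesis) — to be re-applied after every block change of `S`-coordinates;
* `tpw_block_frame_identity`: a block frame `1₃ ⊕ P` (entries as delivered by `tbf_block_frame`) preserves the frame identity;
* `tpw_R2_branch_zero`: DESCENDANT `t̄ = 0` — if the `S`-block of `d` vanishes then `(E3)` of …TwelvePartnerR2Blocks reads `G A + Γ B = 1₉`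
  for alternating `G, Γ` and symmetric `A, B`, contradicting `tpc_descendant_zero_obstruction` (E1280-HANDPROOFS §1.0; R2-PARTNER §4(0)).
Nothing about `θ₁₂`; NOT summit progress.

References: this seat lineage (g37 R2-PARTNER §2, §4(0); g39 HANDPROOFS §1.0, (L3)–(L4)).  Axioms: the standard three.
-/

set_option linter.dupNamespace false -- D-0017: single-problem summit ⇒ `QuantumAdvantage.QuantumAdvantage` by design

namespace Summit.QuantumAdvantage.QuantumAdvantage.Theorems.CubicForrelation.NearExactIsExact

open Finset Matrix
open Literature.Computability.QuantumComplexity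
open Literature.Computability.QuantumComplexity.BuzetChailloux (bxor zeroVec bxor_comm bxor_self bxor_zeroVec zeroVec_bxor
  bxor_bxor_cancel_left)

/-! ### `hF1` from the frame identity -/

/-- **`hF1` from the frame identity.**  If `κ(y) ⊕ κ(y ⊕ e₀) = y₁ ∧ y₂` for all `y` (adapted R2 frame with zero offsets) and `d` is the
cubic form of `κ` at unit vectors, then `d(e₀, j, k) = [{j,k} = {e₁, e₂}]`. [this work] -/
theorem tpw_F1_of_frame_identity {m : ℕ} (κ : (Fin (3 + m) → Bool) → Bool) (d : Fin (3 + m) → Fin (3 + m) → Fin (3 + m) → ZMod 2)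
    (hd : ∀ φ j k, d φ j k =
      if ((((κ zeroVec ^^ κ (bxor zeroVec (fun l => decide (l = k)))) ^^
            (κ (bxor zeroVec (fun l => decide (l = j))) ^^ κ (bxor (bxor zeroVec (fun l => decide (l = j))) (fun l => decide (l = k))))) ^^
          ((κ (bxor zeroVec (fun l => decide (l = φ))) ^^ κ (bxor (bxor zeroVec (fun l => decide (l = φ))) (fun l => decide (l = k)))) ^^
            (κ (bxor (bxor zeroVec (fun l => decide (l = φ))) (fun l => decide (l = j))) ^^
              κ (bxor (bxor (bxor zeroVec (fun l => decide (l = φ))) (fun l => decide (l = j))) (fun l => decide (l = k))))))) = true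
      then 1 else 0)
    (hD0 : ∀ y, (κ y ^^ κ (bxor y (fun l => decide (l = Fin.castAdd m (0 : Fin 3))))) =
      (y (Fin.castAdd m (1 : Fin 3)) && y (Fin.castAdd m (2 : Fin 3)))) :
    ∀ j k, d (Fin.castAdd m (0 : Fin 3)) j k =
      if (j = Fin.castAdd m (1 : Fin 3) ∧ k = Fin.castAdd m (2 : Fin 3)) ∨ (j = Fin.castAdd m (2 : Fin 3) ∧ k = Fin.castAdd m (1 : Fin 3))
      then 1 else 0 := by
  have hne12 : (Fin.castAdd m (1 : Fin 3)) ≠ Fin.castAdd m (2 : Fin 3) := by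
    intro h
    have := congrArg Fin.val h
    simp [Fin.val_castAdd] at this
  have key : ∀ A B C D : Bool, (A && C) = false →
      ((if ((A && B) ^^ (C && D)) = true then (1 : ZMod 2) else 0) =
        if (A = true ∧ B = true) ∨ (C = true ∧ D = true) then 1 else 0) := by
    decide
  have hq : ∀ y, (κ y ^^ κ (bxor y (fun l => decide (l = Fin.castAdd m (0 : Fin 3))))) =
      ((y (Fin.castAdd m (1 : Fin 3)) ^^ false) && (y (Fin.castAdd m (2 : Fin 3)) ^^ false)) := fun y => by
    rw [hD0 y, Bool.xor_false, Bool.xor_false]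
  intro j k
  have h1 : d (Fin.castAdd m (0 : Fin 3)) j k = d j k (Fin.castAdd m (0 : Fin 3)) := by
    rw [hd (Fin.castAdd m (0 : Fin 3)) j k, hd j k (Fin.castAdd m (0 : Fin 3)),
      tcf_third_swap12 κ (fun l => decide (l = Fin.castAdd m (0 : Fin 3))) (fun l => decide (l = j)) (fun l => decide (l = k)) zeroVec,
      tcf_third_swap23 κ (fun l => decide (l = j)) (fun l => decide (l = Fin.castAdd m (0 : Fin 3))) (fun l => decide (l = k)) zeroVec]
  rw [h1, hd j k (Fin.castAdd m (0 : Fin 3)),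
    tct_third_of_product_slice κ (fun l => decide (l = Fin.castAdd m (0 : Fin 3))) (Fin.castAdd m (1 : Fin 3)) (Fin.castAdd m (2 : Fin 3))
      false false hq (fun l => decide (l = j)) (fun l => decide (l = k)) zeroVec]
  have hAC : (decide (Fin.castAdd m (1 : Fin 3) = j) && decide (Fin.castAdd m (2 : Fin 3) = j)) = false := by
    by_cases hj : Fin.castAdd m (1 : Fin 3) = j
    · have hj' : ¬ Fin.castAdd m (2 : Fin 3) = j := fun h' => hne12 (hj.trans h'.symm)
      simp [hj']
    · simp [hj]
  rw [key _ _ _ _ hAC]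
  simp only [decide_eq_true_eq]
  have hiff : ((Fin.castAdd m (1 : Fin 3) = j ∧ Fin.castAdd m (2 : Fin 3) = k) ∨ (Fin.castAdd m (2 : Fin 3) = j ∧ Fin.castAdd m (1 : Fin 3) = k)) ↔
      ((j = Fin.castAdd m (1 : Fin 3) ∧ k = Fin.castAdd m (2 : Fin 3)) ∨ (j = Fin.castAdd m (2 : Fin 3) ∧ k = Fin.castAdd m (1 : Fin 3))) := by
    constructor
    · rintro (⟨h1, h2⟩ | ⟨h1, h2⟩)
      · exact Or.inl ⟨h1.symm, h2.symm⟩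
      · exact Or.inr ⟨h1.symm, h2.symm⟩
    · rintro (⟨h1, h2⟩ | ⟨h1, h2⟩)
      · exact Or.inl ⟨h1.symm, h2.symm⟩
      · exact Or.inr ⟨h1.symm, h2.symm⟩
  simp only [hiff]

/-! ### Block frames preserve the frame identity -/

/-- **A block frame `1₃ ⊕ P` keeps the frame identity.**  If `L` on `3 + m` bits has the block entries of `tbf_block_frame`
(`1₃` on the `y`-block, `0` off-diagonal) and `κ(y) ⊕ κ(y ⊕ e₀) = y₁ y₂`, then `κ' := κ ∘ (L·)` satisfies the same identity
(`L e₀ = e₀` and `(L y)₁ = y₁`, `(L y)₂ = y₂`). [this work] -/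
theorem tpw_block_frame_identity {m : ℕ} (κ : (Fin (3 + m) → Bool) → Bool) (L : Fin (3 + m) → Fin (3 + m) → ZMod 2)
    (hyy : ∀ t t', L (Fin.castAdd m t) (Fin.castAdd m t') = if t = t' then 1 else 0)
    (hys : ∀ t σ, L (Fin.castAdd m t) (Fin.natAdd 3 σ) = 0) (hsy : ∀ σ t, L (Fin.natAdd 3 σ) (Fin.castAdd m t) = 0)
    (hD0 : ∀ y, (κ y ^^ κ (bxor y (fun l => decide (l = Fin.castAdd m (0 : Fin 3))))) =
      (y (Fin.castAdd m (1 : Fin 3)) && y (Fin.castAdd m (2 : Fin 3)))) (b : Fin (3 + m) → Bool)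
    (hb1 : b (Fin.castAdd m (1 : Fin 3)) = false) (hb2 : b (Fin.castAdd m (2 : Fin 3)) = false) :
    ∀ y, ((κ (bxor b (fun ψ => decide ((∑ φ, L ψ φ * (if y φ = true then (1 : ZMod 2) else 0)) = 1)))) ^^
        (κ (bxor b (fun ψ => decide ((∑ φ, L ψ φ *
          (if (bxor y (fun l => decide (l = Fin.castAdd m (0 : Fin 3)))) φ = true then (1 : ZMod 2) else 0)) = 1))))) =
      (y (Fin.castAdd m (1 : Fin 3)) && y (Fin.castAdd m (2 : Fin 3))) := by
  -- `L e₀ = e₀`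
  have hLe0 : (fun ψ => decide ((∑ φ, L ψ φ *
      (if (fun l => decide (l = Fin.castAdd m (0 : Fin 3))) φ = true then (1 : ZMod 2) else 0)) = 1)) =
      fun l => decide (l = Fin.castAdd m (0 : Fin 3)) := by
    have h := tct_lin_single L (Fin.castAdd m (0 : Fin 3))
    have h' : (fun ψ => decide ((∑ φ, L ψ φ *
        (if (fun l => decide (l = Fin.castAdd m (0 : Fin 3))) φ = true then (1 : ZMod 2) else 0)) = 1)) =
        fun ψ => decide ((∑ φ', L ψ φ' * (if decide (φ' = Fin.castAdd m (0 : Fin 3)) = true then (1 : ZMod 2) else 0)) = 1) := rfl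
    rw [h', h]
    funext ψ
    refine Fin.addCases (fun t => ?_) (fun σ => ?_) ψ
    · rw [hyy]
      by_cases ht : t = 0
      · subst ht; simp
      · have hne : Fin.castAdd m t ≠ Fin.castAdd m (0 : Fin 3) := fun h => ht (by
          have := congrArg Fin.val h; simp only [Fin.val_castAdd] at this; exact Fin.ext this)
        simp [ht, hne]
    · rw [hsy]
      have hne : Fin.natAdd 3 σ ≠ Fin.castAdd m (0 : Fin 3) := fun h => by
        have := congrArg Fin.val h; simp only [Fin.val_natAdd, Fin.val_castAdd] at this; omega
      simp [hne]
  -- `(b ⊕ L y)_t = y_t` for `t = 1, 2`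
  have hcoord : ∀ (y : Fin (3 + m) → Bool) (t : Fin 3), b (Fin.castAdd m t) = false →
      (bxor b (fun ψ => decide ((∑ φ, L ψ φ * (if y φ = true then (1 : ZMod 2) else 0)) = 1))) (Fin.castAdd m t) =
        y (Fin.castAdd m t) := by
    intro y t hbt
    show (b (Fin.castAdd m t) ^^ decide ((∑ φ, L (Fin.castAdd m t) φ * (if y φ = true then (1 : ZMod 2) else 0)) = 1)) = _
    rw [hbt, Bool.false_xor, Fin.sum_univ_add]
    have h2 : (∑ σ : Fin m, L (Fin.castAdd m t) (Fin.natAdd 3 σ) * (if y (Fin.natAdd 3 σ) = true then (1 : ZMod 2) else 0)) = 0 :=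
      Finset.sum_eq_zero fun σ _ => by rw [hys, zero_mul]
    have h1 : (∑ t' : Fin 3, L (Fin.castAdd m t) (Fin.castAdd m t') * (if y (Fin.castAdd m t') = true then (1 : ZMod 2) else 0)) =
        if y (Fin.castAdd m t) = true then (1 : ZMod 2) else 0 := by
      rw [Finset.sum_eq_single t]
      · rw [hyy, if_pos rfl, one_mul]
      · intro t' _ ht'; rw [hyy, if_neg (Ne.symm ht'), zero_mul]
      · intro h; exact absurd (mem_univ t) h
    rw [h1, h2, add_zero]
    cases y (Fin.castAdd m t) <;> decide
  intro y
  rw [tct_lin_bxor L y, hLe0]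
  have hassoc : bxor b (bxor (fun ψ => decide ((∑ φ, L ψ φ * (if y φ = true then (1 : ZMod 2) else 0)) = 1))
      (fun l => decide (l = Fin.castAdd m (0 : Fin 3)))) =
      bxor (bxor b (fun ψ => decide ((∑ φ, L ψ φ * (if y φ = true then (1 : ZMod 2) else 0)) = 1)))
        (fun l => decide (l = Fin.castAdd m (0 : Fin 3))) := (iw_bxor_assoc _ _ _).symm
  rw [hassoc, hD0, hcoord y 1 hb1, hcoord y 2 hb2]

/-! ### Descendant `t̄ = 0` -/

/-- **Descendant `0` of the R2 branch.**  In the adapted frame (`hF1`), if the `S`-block of the cubic form vanishes (`t̄ = 0`: the light cell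
is identically `0`, R2-PARTNER §4(0)), the partner equations `(E3)` of …TwelvePartnerR2Blocks give `G A + Γ B = 1₉` for the alternating
blocks `G = d(y₂,·,·)|_S`, `Γ = d(y₃,·,·)|_S` and the symmetric blocks `A, B` of `c` — impossible by the trace identity
`tpc_descendant_zero_obstruction` (E1280-HANDPROOFS §1.0; LEAN p384191). [this work] -/
theorem tpw_R2_branch_zero (c d : Fin (3 + 9) → Fin (3 + 9) → Fin (3 + 9) → ZMod 2)
    (hcs : ∀ p j k, c p k j = c p j k) (hcc : ∀ p j k, c j p k = c p j k)
    (hds : ∀ φ j k, d φ k j = d φ j k) (hdc : ∀ φ j k, d j φ k = d φ j k) (hdd : ∀ φ j, d φ j j = 0)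
    (hpair : ∀ p φ, (∑ j, ∑ k, (if j < k then c p j k * d φ j k else 0)) = if p = φ then 1 else 0)
    (hF1 : ∀ j k, d (Fin.castAdd 9 0) j k =
      if (j = Fin.castAdd 9 1 ∧ k = Fin.castAdd 9 2) ∨ (j = Fin.castAdd 9 2 ∧ k = Fin.castAdd 9 1) then 1 else 0)
    (htb : ∀ σ τ υ : Fin 9, d (Fin.natAdd 3 σ) (Fin.natAdd 3 τ) (Fin.natAdd 3 υ) = 0) : False := by
  have hE3 := tpb_E3 c d hcs hcc hds hdc hdd hpair hF1
  set G : Matrix (Fin 9) (Fin 9) (ZMod 2) := Matrix.of fun f s => d (Fin.castAdd 9 1) (Fin.natAdd 3 f) (Fin.natAdd 3 s) with hG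
  set Γ : Matrix (Fin 9) (Fin 9) (ZMod 2) := Matrix.of fun f s => d (Fin.castAdd 9 2) (Fin.natAdd 3 f) (Fin.natAdd 3 s) with hΓ
  set A : Matrix (Fin 9) (Fin 9) (ZMod 2) := Matrix.of fun s x => c (Fin.castAdd 9 1) (Fin.natAdd 3 s) (Fin.natAdd 3 x) with hA
  set B : Matrix (Fin 9) (Fin 9) (ZMod 2) := Matrix.of fun s x => c (Fin.castAdd 9 2) (Fin.natAdd 3 s) (Fin.natAdd 3 x) with hB
  refine tpc_descendant_zero_obstruction G A Γ B (fun i => hdd _ _) ?_ ?_ (fun i => hdd _ _) ?_ ?_ ?_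
  · ext i j; exact hds _ _ _
  · ext i j; exact hcs _ _ _
  · ext i j; exact hds _ _ _
  · ext i j; exact hcs _ _ _
  · ext f x
    rw [Matrix.add_apply, Matrix.mul_apply, Matrix.mul_apply, Matrix.one_apply, ← Finset.sum_add_distrib]
    have h := hE3 f x
    have h0 : (∑ s : Fin 9, ∑ t : Fin 9, (if s < t then c (Fin.natAdd 3 x) (Fin.natAdd 3 s) (Fin.natAdd 3 t) *
        d (Fin.natAdd 3 f) (Fin.natAdd 3 s) (Fin.natAdd 3 t) else 0)) = 0 :=
      Finset.sum_eq_zero fun s _ => Finset.sum_eq_zero fun t _ => by rw [htb, mul_zero, ite_self]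
    rw [h0, add_zero] at h
    simpa only [hG, hΓ, hA, hB, Matrix.of_apply] using h

end Summit.QuantumAdvantage.QuantumAdvantage.Theorems.CubicForrelation.NearExactIsExact
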